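import Summits.Langlands.Langlands.Theses.WeilRestrictionSplit

/-!
# Glue of the holomorphic-limit split of `NonRegularizableAutomorphy` (route WeilRestrictionSplit)

Closes the glue item of the split `NonRegularizableAutomorphy ⟸ HolomorphicLimitAutomorphy ∧ NonLimitIrregularAutomorphy ∧
LimitMoveTransport` (`NonRegularizableAutomorphy_of_hlsplit : HolomorphicLimitAutomorphy → NonLimitIrregularAutomorphy → LimitMoveTransport → NonRegularizableAutomorphy`), filed by
`ledger route edit route-Langlands-WeilRestrictionSplit --split NonRegularizableAutomorphy --into children.json --glue-decl-name NonRegularizableAutomorphy_of_hlsplit`.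
Pure logic — excluded middle on the inlined holomorphic-limit-move dial LIMMOVE(ρ/K); a limit move whose avatar R' is HT-regular is
a regularizing move (contradicting the parent's hypothesis ¬MOVE(ρ/K)), otherwise `HolomorphicLimitAutomorphy` makes R' automorphic
over the totally real F₁ and `LimitMoveTransport` carries automorphy back to ρ.  This is the lens-3 g8 node proof
`WeilRestrictionSplit.nonRegularizable_of_split` (decomp-langlands, 2026-08-30; certified as `NonRegularizableAutomorphy_of_hlsplit_proof` in the node's kit check
`nodes/lens-3-g8-HolomorphicLimitSplit.kit_check_split.lean`), transported verbatim to the tree's declarations.  No definitions.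
-/

set_option linter.dupNamespace false -- project-wide option; `Summit.Langlands.Langlands` is the mandated namespace

namespace Summit.Langlands.Langlands.Theorems

open Summit.Langlands.Langlands.Theses.WeilRestrictionSplit in
/-- The glue item of the holomorphic-limit split of `NonRegularizableAutomorphy` (IRR*_TR) on route WeilRestrictionSplit: the three
children imply the parent (excluded middle on the holomorphic-limit move; a limit move with an HT-regular avatar would be a
regularizing move). -/
theorem NonRegularizableAutomorphy_of_hlsplit_proof :
    Summit.Langlands.Langlands.Theses.WeilRestrictionSplit.NonRegularizableAutomorphy_of_hlsplit := by
  intro hHL hNL hLMT K _ _ hK n hcpt hn ℓ _ ι ρ hirr hgeo hnm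
  refine (Classical.em _).elim (fun hlim => ?_) (fun hnlim => hNL K hK n hcpt hn ℓ ι ρ hirr hgeo hnm hnlim)
  obtain ⟨M, E₀, i₁, i₂, i₃, i₄, i₅, i₆, i₇, i₈, i₉, hsolv₀, F₁, E₁, j₁, j₂, j₃, j₄, j₅, j₆, j₇, j₈, j₉, hF₁, hsolv₁,
    m, θ, hm, hθirr, hθρ, χ, n', R', hn', hR'irr, hR'geo, h4, hodd, hmult, hθχ⟩ := hlim
  -- R' is not HT-regular: otherwise the SAME data is a regularizing move of ρ, contradicting ¬ MOVE(ρ)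
  have hnreg := fun hreg : _ => hnm ⟨M, E₀, i₁, i₂, i₃, i₄, i₅, i₆, i₇, i₈, i₉, hsolv₀, F₁, E₁, j₁, j₂, j₃, j₄, j₅,
    j₆, j₇, j₈, j₉, hF₁, hsolv₁, m, θ, hm, hθirr, hθρ, χ, n', R', hn', hR'irr, hR'geo, hreg, hθχ⟩
  -- HL_TR makes R' automorphic over the totally real F₁ (case ¬ HT-regular); LMT transports automorphy back to ρ
  exact hLMT K n ℓ ι ρ hirr hgeo hn M E₀ hsolv₀ F₁ E₁ hsolv₁ hF₁ m θ hm hθirr hθρ χ n' R' hn' hR'irr hR'geo h4 hodd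
    hmult hnreg hθχ (fun hcpt' => (Classical.em _).elim (fun hreg => (hnreg hreg).elim)
      (fun hreg => hHL F₁ hF₁ n' hcpt' hn' ℓ ι R' hR'irr hR'geo h4 hodd hmult hreg)) hcpt

end Summit.Langlands.Langlands.Theorems
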